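import Literature.MathematicalPhysics.QuantumFieldTheory.Balaban1983to89.B8Thm4ExistsLocal
import Literature.MathematicalPhysics.QuantumFieldTheory.Balaban1983to89.B8Eq140Level
import Literature.MathematicalPhysics.QuantumFieldTheory.Balaban1983to89.B8Eq138LandauZd
import Literature.MathematicalPhysics.QuantumFieldTheory.Balaban1983to89.B8Ineq170
import HarnessLib

/-!
# `hP1room` PROGRAMME (LEAD-H «H = hSupU» BOARD v2, RULING L-10 [R-h]): ★★ [R-h]-a — THE A PRIORI CHART ROW OF THE TOP GAUGE-FIXED FIELD
# «`W^λ = e^{iη·logCfg η W^λ}`, `‖logCfg η W^λ‖ ≤ (2c + 8α₄)(Lʲη)⁻¹` on the sides touching `Ω_j`» ([Balaban1985RegularSpaces] (1.110)–(1.111)) FROM THE INPUT ONE-FORM's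
# (1.69)-row `‖A‖ ≤ c(Lʲη)⁻¹` AND PROPOSITION 5's (1.108) `|λ|, (Lʲη)|D^ηλ| ≤ α₄` — the `hWA` binder of ✓`HalvingP1FlatCoreTopSizes.prop3_sizes_top`

Route `UnitScaleTilt`, crux K1 child «MinimiserStabilityRegPr» (stmt-QuantumFields-19200), registered stub `stub_halvingStep` (`BirthV10`), text
`hP1room ⟸ hSupU ⟸` nine content rows (✓p643656); row [R-h] ⟸ ✓p644380∕✓p644717 `…TopSizes(Member)` whose datum row `hWA` THIS FILE supplies by name.
Cell `ym3-torus` (HUMAN RULING D-0037: YM₃ on T³ is ladder rung R3 — NOT d = 4, NOT a mass gap, NOT the Clay problem), width seat `ym-ust-19200-w6` gen 2.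
`--supports stmt-QuantumFields-19200 --as helper`; THEOREMS ONLY (0 `def`, 0 `sorry`); count-neutral; nothing here claims `core′`, `hP1room`, `hSupU`, the stub, the crux or the gap.

WHAT (any `ℤᵈ`, any complete normed `ℂ`-algebra `𝔸` with `‖1‖ = 1`, any background `U₀`): ★★`chartRow_gaugeFixed_of_sizes` — for `W^λ := mgauge U₀ (gaugeExp λ)⁻¹ (cfgExp η A)`,
under `‖A y τ‖ ≤ c·(Lʲη)⁻¹` and `‖λ y‖ ≤ α₄`, `(Lʲη)·‖D^η_{U₀,τ}λ(y)‖ ≤ α₄` on the sides touching `Ω_j` (`j ≤ k`), `α₄ ≤ 1∕84`, `c ≤ 1∕12`, `L ≥ 1`, `η > 0`: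
on those sides `W^λ y τ = cfgExp η (logCfg η W^λ) y τ`, `‖logCfg η W^λ y τ‖ ≤ (2c + 8α₄)·(Lʲη)⁻¹`, and `‖W^λ y τ − 1‖ ≤ 1∕4` — n04-b's ✓`B8Thm4ExistsLocal.bond_1110_local`
bond by bond with `v := gaugeExp λ`, `t := (Lʲη)⁻¹` (`ηt = L^{−j} ≤ 1`).  At `c := L·c⋆` (the input's c⋆-row after the level shift of Theorem 4's induction) the size is the
`2(L·c⋆) + 8α₄` of ✓`prop3_sizes_top`'s `hWA`∕`H42`∕`H59` guards VERBATIM (★`hWA_gaugeFixed_of_sizes`); ★`datumGuards_gaugeFixed` — the datum's `hu`∕`hW` rows for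
`u := u₁·e^{iλ}` (C⋆-algebra values: `e^{iλ}` unitary for self-adjoint `λ`).
HONEST SCOPE.  A re-reading of (1.110)–(1.111) by name; the input rows ((1.69) for `A`, (1.108) for `λ`) stay displayed — in the H-line they are the top step's input sizes
and ✓p636261's conclusion (3).

References: T. Bałaban, CMP **99** (1985) 75–102 [Balaban1985RegularSpaces] ((1.110)–(1.111) p.95, (1.108) p.94, (1.69) p.88, (1.84) p.90).
-/

set_option autoImplicit false

noncomputable section

open NormedSpace

namespace Summit.QuantumFields.YangMills.Theorems.HalvingP1FlatCoreTopSizes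

open Literature.MathematicalPhysics.QuantumFieldTheory.Balaban1983to89
open Complex (I)
open MatrixLog B7Prop1Explicit B7Prop2Explicit B7Prop1Local B7Eq92Concrete
open B7Prop1Explicit renaming Site → LSite
open B8Ineq132 (covDerivFwd)
open B8Eq140Level (SideTouches)
open B8Eq184Proof (gaugeExp cfgExp)
open B8Eq138LandauZd (logCfg)
open B8Thm4ExistsLocal (bond_1110_local)

variable {d : ℕ} {𝔸 : Type*} [NormedRing 𝔸] [NormedAlgebra ℂ 𝔸] [NormOneClass 𝔸] [CompleteSpace 𝔸]

/-- ★★ **[R-h]-a: THE A PRIORI CHART ROW OF THE GAUGE-FIXED FIELD ON THE SIDES TOUCHING `Ω_j`** ((1.110)–(1.111)): for `W^λ := U₁^{(e^{iλ})⁻¹}` with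
`U₁ = e^{iηA}` at the background `U₀`, the input row `‖A y τ‖ ≤ c·(Lʲη)⁻¹` and Proposition 5's (1.108) `‖λ y‖ ≤ α₄`, `(Lʲη)·‖(D^η_{U₀}λ)_τ(y)‖ ≤ α₄` on every side touching
`Ω_j`, `j ≤ k` (`α₄ ≤ 1∕84`, `c ≤ 1∕12`): there `W^λ = e^{iη·logCfg η W^λ}`, `‖logCfg η W^λ y τ‖ ≤ (2c + 8α₄)·(Lʲη)⁻¹` and `‖W^λ y τ − 1‖ ≤ 1∕4` (✓`bond_1110_local` per bond,
`t := (Lʲη)⁻¹`). With `c := L·c⋆` this is ✓`prop3_sizes_top`'s datum row `hWA`. [cite: Balaban1985RegularSpaces, (1.110)-(1.111) p.95, (1.108) p.94, (1.69) p.88] -/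
theorem chartRow_gaugeFixed_of_sizes {η : ℝ} (hη : 0 < η) {L : ℕ} (hL1 : 1 ≤ L) (k : ℕ) (U₀ : LSite d → Fin d → 𝔸ˣ)
    (Ω : ℕ → Set (LSite d)) (A : LSite d → Fin d → 𝔸) (lam : LSite d → 𝔸) {c α₄ : ℝ} (hc : 0 ≤ c) (hα₄ : 0 ≤ α₄)
    (hs₁ : α₄ ≤ 1 / 84) (hs₂ : c ≤ 1 / 12)
    (h69 : ∀ j, j ≤ k → ∀ (y : LSite d) (τ : Fin d), SideTouches (Ω j) y τ → ‖A y τ‖ ≤ c * ((L : ℝ) ^ j * η)⁻¹)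
    (h108 : ∀ j, j ≤ k → ∀ (y : LSite d) (τ : Fin d), SideTouches (Ω j) y τ →
      ‖lam y‖ ≤ α₄ ∧ ((L : ℝ) ^ j * η) * ‖covDerivFwd η U₀ τ lam y‖ ≤ α₄) :
    ∀ j, j ≤ k → ∀ (y : LSite d) (τ : Fin d), SideTouches (Ω j) y τ →
      (mgauge U₀ (gaugeExp lam)⁻¹ (cfgExp η A) y τ =
          cfgExp η (logCfg η (mgauge U₀ (gaugeExp lam)⁻¹ (cfgExp η A))) y τ ∧
        ‖logCfg η (mgauge U₀ (gaugeExp lam)⁻¹ (cfgExp η A)) y τ‖ ≤ (2 * c + 8 * α₄) * ((L : ℝ) ^ j * η)⁻¹) ∧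
      ‖((mgauge U₀ (gaugeExp lam)⁻¹ (cfgExp η A) y τ : 𝔸ˣ) : 𝔸) - 1‖ ≤ 1 / 4 := by
  intro j hj y τ hs
  have hLr : (1 : ℝ) ≤ L := by exact_mod_cast hL1
  have hpos : (0 : ℝ) < (L : ℝ) ^ j * η := by positivity
  have ht : 0 ≤ ((L : ℝ) ^ j * η)⁻¹ := by positivity
  have hηt : η * ((L : ℝ) ^ j * η)⁻¹ ≤ 1 := by
    have hLj : (1 : ℝ) ≤ (L : ℝ) ^ j := one_le_pow₀ hLr
    have e : η * ((L : ℝ) ^ j * η)⁻¹ = ((L : ℝ) ^ j)⁻¹ := by field_simp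
    rw [e]
    exact inv_le_one_of_one_le₀ hLj
  obtain ⟨hl, hD'⟩ := h108 j hj y τ hs
  have hD : ‖covDerivFwd η U₀ τ lam y‖ ≤ α₄ * ((L : ℝ) ^ j * η)⁻¹ := by
    rw [← div_eq_mul_inv]
    exact (le_div_iff₀' hpos).2 hD'
  obtain ⟨hbd, hexp, hnear⟩ := bond_1110_local hη U₀ (cfgExp η A) (gaugeExp lam) A τ hc hα₄ ht hηt rfl rfl rfl hl hD
    (h69 j hj y τ hs) hs₁ hs₂
  exact ⟨⟨hexp.symm, hbd⟩, hnear⟩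

/-- ★ **THE SAME IN ✓`prop3_sizes_top`'s `hWA` SHAPE AT `c := L·c⋆`** (the level shift of Theorem 4's induction already applied to the input row): the two-conjunct chart row
`W^λ = cfgExp η X₀ ∧ ‖X₀‖ ≤ (2(L·c⋆) + 8α₄)(Lʲη)⁻¹` for `X₀ := logCfg η W^λ` on every side touching `Ω_j`, `j ≤ k`.
[cite: Balaban1985RegularSpaces, (1.110)-(1.111) p.95, (1.69) p.88, Thm 4 p.88] -/
theorem hWA_gaugeFixed_of_sizes {η : ℝ} (hη : 0 < η) {L : ℕ} (hL1 : 1 ≤ L) (k : ℕ) (U₀ : LSite d → Fin d → 𝔸ˣ)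
    (Ω : ℕ → Set (LSite d)) (A : LSite d → Fin d → 𝔸) (lam : LSite d → 𝔸) {cstar α₄ : ℝ} (hc : 0 ≤ cstar) (hα₄ : 0 ≤ α₄)
    (hs₁ : α₄ ≤ 1 / 84) (hs₂ : L * cstar ≤ 1 / 12)
    (h69 : ∀ j, j ≤ k → ∀ (y : LSite d) (τ : Fin d), SideTouches (Ω j) y τ → ‖A y τ‖ ≤ L * cstar * ((L : ℝ) ^ j * η)⁻¹)
    (h108 : ∀ j, j ≤ k → ∀ (y : LSite d) (τ : Fin d), SideTouches (Ω j) y τ →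
      ‖lam y‖ ≤ α₄ ∧ ((L : ℝ) ^ j * η) * ‖covDerivFwd η U₀ τ lam y‖ ≤ α₄) :
    ∀ j, j ≤ k → ∀ (y : LSite d) (τ : Fin d), SideTouches (Ω j) y τ →
      mgauge U₀ (gaugeExp lam)⁻¹ (cfgExp η A) y τ =
          cfgExp η (logCfg η (mgauge U₀ (gaugeExp lam)⁻¹ (cfgExp η A))) y τ ∧
        ‖logCfg η (mgauge U₀ (gaugeExp lam)⁻¹ (cfgExp η A)) y τ‖ ≤ (2 * (L * cstar) + 8 * α₄) * ((L : ℝ) ^ j * η)⁻¹ :=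
  fun j hj y τ hs =>
    (chartRow_gaugeFixed_of_sizes hη hL1 k U₀ Ω A lam (c := L * cstar) (by positivity) hα₄ hs₁ hs₂ h69 h108 j hj y τ hs).1

/-! ## The datum's guards: `u := u₁·e^{iλ}` is unitary-valued and gauges `W^λ` back to `U′` -/

section Guards

variable {𝔹 : Type*} [CStarAlgebra 𝔹]

/-- **THE DATUM's GUARDS FOR ✓`prop3_sizes_top`**: if `u₁` is unitary-valued with `U₁^{u₁} = U′` and `λ` is self-adjoint, then `u := u₁·e^{iλ}` is unitary-valued
(`e^{iλ}` unitary, ✓`B8Ineq170.exp_I_smul_mem_unitary`) and `(W^λ)^{u} = U′` for `W^λ := U₁^{(e^{iλ})⁻¹}` (✓`B7Eq106Concrete.mgauge_mgauge`) — the rows `hu`, `hW` of the door's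
datum, as in Theorem 4's step `u = u′u₁`. [cite: Balaban1985RegularSpaces, Thm 4 p.88, (1.77) p.90, p.94 («a gauge transformation u = u′u₁»)] -/
theorem datumGuards_gaugeFixed (U₀ U' U₁ : LSite d → Fin d → 𝔹ˣ) (u₁ : LSite d → 𝔹ˣ) (lam : LSite d → 𝔹)
    (hu₁ : ∀ x, u₁ x ∈ unitaryUnits 𝔹) (hsa : ∀ x, IsSelfAdjoint (lam x)) (h₁ : mgauge U₀ u₁ U₁ = U') :
    (∀ x, (u₁ * gaugeExp lam) x ∈ unitaryUnits 𝔹) ∧ mgauge U₀ (u₁ * gaugeExp lam) (mgauge U₀ (gaugeExp lam)⁻¹ U₁) = U' := by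
  refine ⟨fun x => ?_, ?_⟩
  · rw [Pi.mul_apply]
    refine (unitaryUnits 𝔹).mul_mem (hu₁ x) ?_
    rw [mem_unitaryUnits, gaugeExp, val_expUnit]
    exact B8Ineq170.exp_I_smul_mem_unitary (hsa x)
  · rw [B7Eq106Concrete.mgauge_mgauge, mul_assoc, mul_inv_cancel, mul_one, h₁]

end Guards

/-! ## v1.1 (append-only): the level shift of Theorem 4's induction — the input row at `c⋆` on `j ≤ m` read as an `L·c⋆` row on `j ≤ m + 1` -/

section LevelShift

variable {E : Type*} [SeminormedAddCommGroup E]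

/-- ★ **THE LEVEL SHIFT** ([Balaban1985RegularSpaces] p.88: the inductive datum's «`|A| < c⋆(Lʲη)⁻¹` on `Ω_j`, `j ≤ k − 1`» read one level up as «`|A| < L·c⋆(Lʲη)⁻¹`, `j ≤ k`»,
`Ω` antitone): from `‖A y τ‖ ≤ c⋆·(Lʲη)⁻¹` on the sides touching `Ω_j` for `j ≤ m` to `‖A y τ‖ ≤ L·c⋆·(Lʲη)⁻¹` on the sides touching `Ω_j` for `j ≤ m + 1` (`L ≥ 1`, `η > 0`, `0 ≤ c⋆`;
at `j = m + 1` through `SideTouches (Ω (m+1)) ⊆ SideTouches (Ω m)`, ✓`B8Eq140Level.sideTouches_mono`) — the `h69` input of ★`hWA_gaugeFixed_of_sizes` from the datum row `hdat` of the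
STAGE 3b top call (the private `level_shift` of ✓`B8Thm4InductionLocal`, exported in side letters). [cite: Balaban1985RegularSpaces, Thm 4 p.88, (1.69) p.88, (1.3) p.77] -/
theorem inputRow_levelShift {η : ℝ} (hη : 0 < η) {L : ℕ} (hL1 : 1 ≤ L) (m : ℕ) (Ω : ℕ → Set (LSite d)) (hΩ : ∀ j, Ω (j + 1) ⊆ Ω j)
    (A : LSite d → Fin d → E) {cstar : ℝ} (hc : 0 ≤ cstar)
    (hdat : ∀ j, j ≤ m → ∀ (y : LSite d) (τ : Fin d), SideTouches (Ω j) y τ → ‖A y τ‖ ≤ cstar * ((L : ℝ) ^ j * η)⁻¹) :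
    ∀ j, j ≤ m + 1 → ∀ (y : LSite d) (τ : Fin d), SideTouches (Ω j) y τ → ‖A y τ‖ ≤ L * cstar * ((L : ℝ) ^ j * η)⁻¹ := by
  intro j hj y τ hs
  have hLr : (1 : ℝ) ≤ L := by exact_mod_cast hL1
  have hL0 : (0 : ℝ) < L := by linarith
  rcases Nat.lt_or_ge j (m + 1) with hjm | hjm
  · -- `j ≤ m`: `c⋆·t ≤ L·c⋆·t`
    have h := hdat j (by omega) y τ hs
    have ht : 0 ≤ ((L : ℝ) ^ j * η)⁻¹ := by positivity
    calc ‖A y τ‖ ≤ cstar * ((L : ℝ) ^ j * η)⁻¹ := h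
      _ = 1 * (cstar * ((L : ℝ) ^ j * η)⁻¹) := (one_mul _).symm
      _ ≤ (L : ℝ) * (cstar * ((L : ℝ) ^ j * η)⁻¹) := mul_le_mul_of_nonneg_right hLr (mul_nonneg hc ht)
      _ = L * cstar * ((L : ℝ) ^ j * η)⁻¹ := by ring
  · -- `j = m + 1`: the side touches `Ω m ⊇ Ω (m+1)`, and `c⋆·(Lᵐη)⁻¹ = L·c⋆·(L^{m+1}η)⁻¹`
    obtain rfl : j = m + 1 := le_antisymm hj hjm
    have hs' : SideTouches (Ω m) y τ := B8Eq140Level.sideTouches_mono (hΩ m) hs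
    have h := hdat m le_rfl y τ hs'
    have e : cstar * ((L : ℝ) ^ m * η)⁻¹ = L * cstar * ((L : ℝ) ^ (m + 1) * η)⁻¹ := by
      rw [pow_succ]
      field_simp
    rwa [e] at h

end LevelShift

end Summit.QuantumFields.YangMills.Theorems.HalvingP1FlatCoreTopSizes

end
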